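import Summits.QuantumFields.BalabanUV.Beta.GAN24.ReadingWeightSums
import Summits.QuantumFields.BalabanUV.Beta.GAN24.CapacitanceScalarDictionary

/-!
# `BalabanUV.Beta.GAN24.ReadingWeightCrossSums` — binder row G-an2-4 / (CONV-C), road P1-fibre: the CROSS alias sums of the reading
# weights against the block weights (self-row P1-Y09x*, sequel of typer row P1-Y09b `ReadingWeightSums`; inputs of p1 row L09)

NOT IN PRINT; OUR PROOF ATTEMPT.  HONEST FRAMING (cell contract, verbatim): «discharging `BetaPertH` makes Bałaban's UV stability
UNCONDITIONAL — a real constructive-QFT result; it is NOT the continuum limit and NOT the Clay problem.»  HONEST DEPENDENCY (verbatim):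
«continuum YM on T⁴ ⇐ BetaPertH ∧ nine spine estimates (0/9 proved); BetaPertH ⇐ (D1) ∧ (D4) ∧ CAP+tail; G-an2-4 gates asym, D1 and
NE2/3/4.»  [folklore] trigonometric bookkeeping in the `sinWt`/`aliasWtTerm`/`aliasWtConst` currency of leaf P1-L06 (`GAN24/AliasWeights(+Sum)`,
`alias_sum_le` BY NAME, once) over the objects of typer row P1-T00 (`GAN24/AliasObjects`) and the real-zone dictionary of
`GAN24/CapacitanceScalarDictionary`; 0 `def`, no cited fact, no `def … : Prop`, no wall binder.  NOT summit progress; discharges nothing of the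
K-slot `GAN24.CombesThomas.ConvCK 3 Lc` by itself.

## Why (interface census of the XREAD of P1-Y09b, journal 2026-08-20 l.2931)
Row L09 `FibreUniformBound` plugs the per-alias response bound `α(m)` of row P1-Y09a (`FieldBlockResponse.norm_Ahat_le_param_of_mem_reg`:
`α(m) = √D·(F_m + ‖χ̂(m)‖·S_m·Bφ)/(2‖L_m‖) + ‖χ̂(m)‖·Bc/(‖L_m‖·√‖L_m‖)`) into the plug form of row P1-Y09d (`ClosedFormBoundOfParts`), i.e. it needs
the reading-weight sums `Σ_m ‖readW(m)‖·α(m)`; and at the zero alias (Y09a §4(b), Q-row form) the cross sums `Σ_{m≠0} ‖S(m)s_κ(m)‖·α(m)`.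
Row P1-Y09b supplies the TRANSVERSE/force part (`offZero_sum_le`: `Σ_{m≠0} ‖readW‖·‖N^D srcW‖/(N²·lapR) ≤ (N/M)^{2D}·aliasWtConst D`).  THIS
FILE supplies the remaining sums, all off the zero alias, all at real momenta `p ∈ [−π, π]^D`, `0 < M ≤ N`:
* §1 ENGINE `offZero_weighted_sum_le`: for two nonnegative weight families `u, v` on the aliases with `u(m)² ≤ U²·Π_i sinWt N k_{m,i}`,
  `v(m)² ≤ V²·Π_i sinWt N k_{m,i}`:  `Σ_{m≠0} u(m)·v(m)/(N²·lapR k_m) ≤ U·V·aliasWtConst D`;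
* §2 MAJORISATIONS by `√(Π_i sinWt N k_{m,i})` of T00's weights at real momentum: `‖readW‖` and `‖N^D·srcW‖` (`U = (N/M)^{D+1}`; the source
  weight IS the conjugate reading weight over `N^D`), `‖χ̂(m)‖` (`U = 1`), `‖χ̂(m)‖·‖s♭_l(m)‖` (`U = N`), `‖S(m)‖·‖s_κ(m)‖` (`U = N^{D+1}`);
* §3 the SUMS: φ-FEED `Σ_{m≠0} ‖readW‖·‖χ̂‖‖s♭_l‖/(N² lapR) ≤ (N/M)^{D+1}·N·C`, GAUGE COLUMN `Σ_{m≠0} ‖readW‖·‖χ̂‖/(N² lapR) ≤ (N/M)^{D+1}·C` and its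
  `(N² lapR)^{3/2}` form (factor `1/2`, since `N²·lapR ≥ 4` off zero), and the ZERO-CLASS CROSS SUMS `Σ_{m≠0} ‖S s_κ‖·‖N^D srcW‖/(N² lapR) ≤
  N^{D+1}·(N/M)^{D+1}·C`, `Σ_{m≠0} ‖S s_κ‖·‖χ̂‖/(N² lapR) ≤ N^{D+1}·C` (+ `3/2` form), `Σ_{m≠0} ‖S s_κ‖·‖χ̂‖‖s♭_l‖/(N² lapR) ≤ N^{D+2}·C`,
  `C = aliasWtConst D = (5^D − 1)/4`;
* §4 the denominator dictionary `‖LAl N (ofRealVec p) m‖ = lapR k_m` (so Y09a's `1/‖L_m‖ = N²/(N²·lapR k_m)`).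
Unit count (diagnostic reading only; L09 does it by name): each sum carries exactly the powers of `N` that the matching `Bφ, Bc ~ N^{−(D+4)}×…`
(Y08f §6 ∘ Y08s) and `sf², sf·sm` absorb.  Unit `b2b-balaban-gan24-formalise-leaf-03` (G-an2-4 formalisation swarm), 2026-08-20.
-/

noncomputable section

open Complex Finset
open scoped BigOperators Real ComplexConjugate

namespace Summit.QuantumFields.BalabanUV.Beta.GAN24.ReadingWeightCrossSums

open Literature.Probability.LatticeModels (TorusSite)
open Literature.MathematicalPhysics.QuantumFieldTheory.Balaban1983to89.B4Strip (ofRealVec)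
open AliasWeights (sinWt sinWt_pos sinWt_le_one kfine)
open AliasWeightsSum (lapR lapR_nonneg aliasWtTerm aliasWtConst alias_sum_le four_le_sq_mul_lapR)
open CapacitanceScalarBounds (gNormSq gNormSq_nonneg gNormSq_le_sq_mul_sinWt)
open AliasObjects (sAl SAl sbAl chiAl LAl readW srcW conj_ofRealVec sbAl_eq_conj chiAl_eq_conj srcW_eq_conj)
open CapacitanceScalarDictionary (norm_sq_sAl normSq_SAl LAl_ofRealVec)

variable {D N : ℕ} [NeZero N]

/-! ## §1 The engine: a weighted off-zero alias sum against the T-block majorant -/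

omit [NeZero N] in
/-- [folklore] Product majorisation from squared majorisations: `u² ≤ U²P`, `v² ≤ V²P`, everything nonnegative ⇒ `u·v ≤ U·V·P`. -/
theorem mul_le_of_sq_le {u v U V P : ℝ} (hu0 : 0 ≤ u) (hv0 : 0 ≤ v) (hU : 0 ≤ U) (hV : 0 ≤ V) (hP : 0 ≤ P)
    (hu : u ^ 2 ≤ U ^ 2 * P) (hv : v ^ 2 ≤ V ^ 2 * P) : u * v ≤ U * V * P := by
  have h1 : (u * v) ^ 2 ≤ (U * V * P) ^ 2 := by
    calc (u * v) ^ 2 = u ^ 2 * v ^ 2 := by ring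
      _ ≤ (U ^ 2 * P) * (V ^ 2 * P) := mul_le_mul hu hv (sq_nonneg _) (by positivity)
      _ = (U * V * P) ^ 2 := by ring
  calc u * v = Real.sqrt ((u * v) ^ 2) := (Real.sqrt_sq (mul_nonneg hu0 hv0)).symm
    _ ≤ Real.sqrt ((U * V * P) ^ 2) := Real.sqrt_le_sqrt h1
    _ = U * V * P := Real.sqrt_sq (by positivity)

/-- [folklore] **THE ENGINE.**  For `p ∈ [−π, π]^D` and two nonnegative weight families `u, v` on the aliases, each majorised in square by
`Π_i sinWt N k_{m,i}` with constants `U, V ≥ 0`:  `Σ_{m ≠ 0} u(m)·v(m)/(N²·lapR k_m) ≤ U·V·aliasWtConst D`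
(termwise `≤ U·V·aliasWtTerm N p m`, then leaf P1-L06's `alias_sum_le` BY NAME). -/
theorem offZero_weighted_sum_le {p : Fin D → ℝ} (hp : ∀ i, |p i| ≤ π) (u v : TorusSite D N → ℝ) {U V : ℝ}
    (hU : 0 ≤ U) (hV : 0 ≤ V) (hu0 : ∀ m, 0 ≤ u m) (hv0 : ∀ m, 0 ≤ v m)
    (hu : ∀ m, u m ^ 2 ≤ U ^ 2 * ∏ i, sinWt N (kfine N p m i))
    (hv : ∀ m, v m ^ 2 ≤ V ^ 2 * ∏ i, sinWt N (kfine N p m i)) :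
    ∑ m ∈ (Finset.univ : Finset (TorusSite D N)).erase 0, u m * v m / ((N : ℝ) ^ 2 * lapR (kfine N p m))
      ≤ U * V * aliasWtConst D := by
  classical
  have hterm : ∀ m ∈ (Finset.univ : Finset (TorusSite D N)).erase 0,
      u m * v m / ((N : ℝ) ^ 2 * lapR (kfine N p m)) ≤ U * V * aliasWtTerm N p m := by
    intro m hm
    have hm0 : m ≠ 0 := (Finset.mem_erase.1 hm).1
    have hden : 0 < (N : ℝ) ^ 2 * lapR (kfine N p m) := lt_of_lt_of_le (by norm_num) (four_le_sq_mul_lapR hp hm0)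
    have hP : 0 ≤ ∏ i, sinWt N (kfine N p m i) := Finset.prod_nonneg fun _ _ => (sinWt_pos _ _).le
    have h := mul_le_of_sq_le (hu0 m) (hv0 m) hU hV hP (hu m) (hv m)
    have e : U * V * aliasWtTerm N p m = (U * V * ∏ i, sinWt N (kfine N p m i)) / ((N : ℝ) ^ 2 * lapR (kfine N p m)) := by
      unfold aliasWtTerm; ring
    rw [e]
    exact div_le_div_of_nonneg_right h hden.le
  calc ∑ m ∈ (Finset.univ : Finset (TorusSite D N)).erase 0, u m * v m / ((N : ℝ) ^ 2 * lapR (kfine N p m))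
      ≤ ∑ m ∈ (Finset.univ : Finset (TorusSite D N)).erase 0, U * V * aliasWtTerm N p m := Finset.sum_le_sum hterm
    _ = U * V * ∑ m ∈ (Finset.univ : Finset (TorusSite D N)).erase 0, aliasWtTerm N p m := by rw [Finset.mul_sum]
    _ ≤ U * V * aliasWtConst D := mul_le_mul_of_nonneg_left (alias_sum_le N hp) (mul_nonneg hU hV)

/-- [folklore] The engine with the `3/2` power of the T-block majorant: off the zero alias `N²·lapR ≥ 4`, so
`Σ_{m≠0} u·v/((N² lapR)·√(N² lapR)) ≤ (U·V·aliasWtConst D)/2`. -/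
theorem offZero_weighted_sum_three_halves_le {p : Fin D → ℝ} (hp : ∀ i, |p i| ≤ π) (u v : TorusSite D N → ℝ) {U V : ℝ}
    (hU : 0 ≤ U) (hV : 0 ≤ V) (hu0 : ∀ m, 0 ≤ u m) (hv0 : ∀ m, 0 ≤ v m)
    (hu : ∀ m, u m ^ 2 ≤ U ^ 2 * ∏ i, sinWt N (kfine N p m i))
    (hv : ∀ m, v m ^ 2 ≤ V ^ 2 * ∏ i, sinWt N (kfine N p m i)) :
    ∑ m ∈ (Finset.univ : Finset (TorusSite D N)).erase 0,
        u m * v m / (((N : ℝ) ^ 2 * lapR (kfine N p m)) * Real.sqrt ((N : ℝ) ^ 2 * lapR (kfine N p m)))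
      ≤ U * V * aliasWtConst D / 2 := by
  classical
  have hterm : ∀ m ∈ (Finset.univ : Finset (TorusSite D N)).erase 0,
      u m * v m / (((N : ℝ) ^ 2 * lapR (kfine N p m)) * Real.sqrt ((N : ℝ) ^ 2 * lapR (kfine N p m)))
        ≤ (u m * v m / ((N : ℝ) ^ 2 * lapR (kfine N p m))) / 2 := by
    intro m hm
    have hm0 : m ≠ 0 := (Finset.mem_erase.1 hm).1
    have h4 : 4 ≤ (N : ℝ) ^ 2 * lapR (kfine N p m) := four_le_sq_mul_lapR hp hm0
    have hden : 0 < (N : ℝ) ^ 2 * lapR (kfine N p m) := lt_of_lt_of_le (by norm_num) h4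
    have h2 : 2 ≤ Real.sqrt ((N : ℝ) ^ 2 * lapR (kfine N p m)) := by
      rw [show (2 : ℝ) = Real.sqrt 4 by rw [show (4 : ℝ) = 2 ^ 2 by norm_num, Real.sqrt_sq (by norm_num)]]
      exact Real.sqrt_le_sqrt h4
    have hnum : 0 ≤ u m * v m := mul_nonneg (hu0 m) (hv0 m)
    rw [div_div, div_le_div_iff₀ (mul_pos hden (lt_of_lt_of_le (by norm_num) h2)) (mul_pos hden (by norm_num))]
    have : u m * v m * ((N : ℝ) ^ 2 * lapR (kfine N p m) * 2)
        ≤ u m * v m * ((N : ℝ) ^ 2 * lapR (kfine N p m) * Real.sqrt ((N : ℝ) ^ 2 * lapR (kfine N p m))) :=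
      mul_le_mul_of_nonneg_left (mul_le_mul_of_nonneg_left h2 hden.le) hnum
    linarith
  calc _ ≤ ∑ m ∈ (Finset.univ : Finset (TorusSite D N)).erase 0, (u m * v m / ((N : ℝ) ^ 2 * lapR (kfine N p m))) / 2 :=
        Finset.sum_le_sum hterm
    _ = (∑ m ∈ (Finset.univ : Finset (TorusSite D N)).erase 0, u m * v m / ((N : ℝ) ^ 2 * lapR (kfine N p m))) / 2 := by
        rw [Finset.sum_div]
    _ ≤ U * V * aliasWtConst D / 2 :=
        div_le_div_of_nonneg_right (offZero_weighted_sum_le hp u v hU hV hu0 hv0 hu hv) (by norm_num)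

/-! ## §2 Majorisations of T00's weights by `√(Π_i sinWt N k_{m,i})` at real momentum -/

omit [NeZero N] in
/-- [folklore] `0 ≤ Π_i sinWt N k_{m,i}`. -/
theorem prod_sinWt_nonneg (p : Fin D → ℝ) (m : TorusSite D N) : 0 ≤ ∏ i, sinWt N (kfine N p m i) :=
  Finset.prod_nonneg fun _ _ => (sinWt_pos _ _).le

/-- [folklore] **READING WEIGHT** (`0 < M ≤ N`): `‖readW‖² ≤ ((N/M)^{D+1})²·Π_i sinWt N k_{m,i}` (row P1-Y09b's `norm_readW_sq_le_N` with the
leg-direction factor `sinWt N k_κ ≤ 1` dropped). -/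
theorem norm_readW_sq_le_prod {M : ℕ} (hM : 0 < M) (hMN : M ≤ N) (p : Fin D → ℝ) (m : TorusSite D N) (κ : Fin D)
    (ρ : Fin D → ℤ) :
    ‖readW N M (ofRealVec p) m κ ρ‖ ^ 2 ≤ (((N : ℝ) / M) ^ (D + 1)) ^ 2 * ∏ i, sinWt N (kfine N p m i) := by
  have h := ReadingWeightSums.norm_readW_sq_le_N hM hMN p m κ ρ
  have h1 : (∏ i, sinWt N (kfine N p m i)) * sinWt N (kfine N p m κ) ≤ ∏ i, sinWt N (kfine N p m i) :=
    mul_le_of_le_one_right (prod_sinWt_nonneg p m) (sinWt_le_one _ _)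
  have e : (((N : ℝ) / M) ^ 2) ^ (D + 1) = (((N : ℝ) / M) ^ (D + 1)) ^ 2 := by rw [← pow_mul, ← pow_mul, mul_comm]
  rw [← e]
  exact h.trans (mul_le_mul_of_nonneg_left h1 (by positivity))

/-- [folklore] **SOURCE WEIGHT = CONJUGATE READING WEIGHT** at real momentum: `‖N^D·srcW(m, l, ρ′)‖ = ‖readW(m, l, ρ′)‖`
(T00's `srcW_eq_conj` BY NAME). -/
theorem norm_natPow_mul_srcW_eq (M : ℕ) (p : Fin D → ℝ) (m : TorusSite D N) (l : Fin D) (ρ' : Fin D → ℤ) :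
    ‖(N : ℂ) ^ D * srcW N M (ofRealVec p) m l ρ'‖ = ‖readW N M (ofRealVec p) m l ρ'‖ := by
  have hN : (N : ℂ) ^ D ≠ 0 := pow_ne_zero _ (Nat.cast_ne_zero.2 (NeZero.ne N))
  rw [srcW_eq_conj (conj_ofRealVec p), ← mul_div_assoc, mul_div_cancel_left₀ _ hN, Complex.norm_conj]

/-- [folklore] **SOURCE WEIGHT** (`0 < M ≤ N`): `‖N^D·srcW‖² ≤ ((N/M)^{D+1})²·Π_i sinWt N k_{m,i}`. -/
theorem norm_natPow_mul_srcW_sq_le_prod {M : ℕ} (hM : 0 < M) (hMN : M ≤ N) (p : Fin D → ℝ) (m : TorusSite D N) (l : Fin D)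
    (ρ' : Fin D → ℤ) :
    ‖(N : ℂ) ^ D * srcW N M (ofRealVec p) m l ρ'‖ ^ 2 ≤ (((N : ℝ) / M) ^ (D + 1)) ^ 2 * ∏ i, sinWt N (kfine N p m i) := by
  rw [norm_natPow_mul_srcW_eq]
  exact norm_readW_sq_le_prod hM hMN p m l ρ'

/-- [folklore] **BOX FACTOR**: `‖S(m)‖² ≤ (N²)^D·Π_i sinWt N k_{m,i}` (`|S(m)|² = Π_i gNormSq`, `gNormSq ≤ N²·sinWt` of row P1-Y08s). -/
theorem norm_SAl_sq_le (p : Fin D → ℝ) (m : TorusSite D N) :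
    ‖SAl N (ofRealVec p) m‖ ^ 2 ≤ ((N : ℝ) ^ 2) ^ D * ∏ i, sinWt N (kfine N p m i) := by
  rw [← Complex.normSq_eq_norm_sq, normSq_SAl,
    show ((N : ℝ) ^ 2) ^ D = ∏ _i : Fin D, (N : ℝ) ^ 2 by rw [Finset.prod_const, Finset.card_univ, Fintype.card_fin],
    ← Finset.prod_mul_distrib]
  exact Finset.prod_le_prod (fun _ _ => gNormSq_nonneg _ _) fun _ _ => gNormSq_le_sq_mul_sinWt _ _

/-- [folklore] **DIRECTIONAL BOX SUM**: `‖s_κ(m)‖² ≤ N²·sinWt N k_{m,κ}` and hence `≤ N²`. -/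
theorem norm_sAl_sq_le (p : Fin D → ℝ) (m : TorusSite D N) (κ : Fin D) :
    ‖sAl N (ofRealVec p) m κ‖ ^ 2 ≤ (N : ℝ) ^ 2 * sinWt N (kfine N p m κ) := by
  rw [norm_sq_sAl]; exact gNormSq_le_sq_mul_sinWt _ _

/-- [folklore] `‖s_κ(m)‖² ≤ N²`. -/
theorem norm_sAl_sq_le_sq (p : Fin D → ℝ) (m : TorusSite D N) (κ : Fin D) : ‖sAl N (ofRealVec p) m κ‖ ^ 2 ≤ (N : ℝ) ^ 2 :=
  (norm_sAl_sq_le p m κ).trans (mul_le_of_le_one_right (sq_nonneg _) (sinWt_le_one _ _))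

/-- [folklore] At real momentum the flat directional sum has the same norm: `‖s♭_l(m)‖ = ‖s_l(m)‖`. -/
theorem norm_sbAl_eq (p : Fin D → ℝ) (m : TorusSite D N) (l : Fin D) :
    ‖sbAl N (ofRealVec p) m l‖ = ‖sAl N (ofRealVec p) m l‖ := by
  rw [sbAl_eq_conj (conj_ofRealVec p), Complex.norm_conj]

/-- [folklore] `‖χ̂(m)‖ = ‖S(m)‖/N^D` at real momentum. -/
theorem norm_chiAl_eq (p : Fin D → ℝ) (m : TorusSite D N) :
    ‖chiAl N (ofRealVec p) m‖ = ‖SAl N (ofRealVec p) m‖ / (N : ℝ) ^ D := by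
  rw [chiAl_eq_conj (conj_ofRealVec p), norm_div, Complex.norm_conj, norm_pow, Complex.norm_natCast]

/-- [folklore] **BLOCK-DFT AMPLITUDE**: `‖χ̂(m)‖² ≤ Π_i sinWt N k_{m,i}` (every active alias coordinate costs a factor `(N sin(k_i/2))⁻²`). -/
theorem norm_chiAl_sq_le (p : Fin D → ℝ) (m : TorusSite D N) :
    ‖chiAl N (ofRealVec p) m‖ ^ 2 ≤ ∏ i, sinWt N (kfine N p m i) := by
  have hN : (0 : ℝ) < N := Nat.cast_pos.2 (Nat.pos_of_ne_zero (NeZero.ne N))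
  rw [norm_chiAl_eq, div_pow, div_le_iff₀ (by positivity)]
  calc ‖SAl N (ofRealVec p) m‖ ^ 2 ≤ ((N : ℝ) ^ 2) ^ D * ∏ i, sinWt N (kfine N p m i) := norm_SAl_sq_le p m
    _ = (∏ i, sinWt N (kfine N p m i)) * ((N : ℝ) ^ D) ^ 2 := by ring

/-- [folklore] The engine's shape for `χ̂`: `‖χ̂(m)‖² ≤ 1²·Π_i sinWt N k_{m,i}`. -/
theorem norm_chiAl_sq_le' (p : Fin D → ℝ) (m : TorusSite D N) :
    ‖chiAl N (ofRealVec p) m‖ ^ 2 ≤ (1 : ℝ) ^ 2 * ∏ i, sinWt N (kfine N p m i) := by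
  rw [one_pow, one_mul]; exact norm_chiAl_sq_le p m

/-- [folklore] **φ-FEED WEIGHT**: `(‖χ̂(m)‖·‖s♭_l(m)‖)² ≤ N²·Π_i sinWt N k_{m,i}`. -/
theorem norm_chiAl_mul_sbAl_sq_le (p : Fin D → ℝ) (m : TorusSite D N) (l : Fin D) :
    (‖chiAl N (ofRealVec p) m‖ * ‖sbAl N (ofRealVec p) m l‖) ^ 2 ≤ (N : ℝ) ^ 2 * ∏ i, sinWt N (kfine N p m i) := by
  rw [mul_pow, norm_sbAl_eq]
  calc ‖chiAl N (ofRealVec p) m‖ ^ 2 * ‖sAl N (ofRealVec p) m l‖ ^ 2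
      ≤ (∏ i, sinWt N (kfine N p m i)) * (N : ℝ) ^ 2 :=
        mul_le_mul (norm_chiAl_sq_le p m) (norm_sAl_sq_le_sq p m l) (sq_nonneg _) (prod_sinWt_nonneg p m)
    _ = (N : ℝ) ^ 2 * ∏ i, sinWt N (kfine N p m i) := by ring

/-- [folklore] **Q-ROW WEIGHT**: `(‖S(m)‖·‖s_κ(m)‖)² ≤ (N^{D+1})²·Π_i sinWt N k_{m,i}`. -/
theorem norm_SAl_mul_sAl_sq_le (p : Fin D → ℝ) (m : TorusSite D N) (κ : Fin D) :
    (‖SAl N (ofRealVec p) m‖ * ‖sAl N (ofRealVec p) m κ‖) ^ 2 ≤ ((N : ℝ) ^ (D + 1)) ^ 2 * ∏ i, sinWt N (kfine N p m i) := by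
  rw [mul_pow]
  calc ‖SAl N (ofRealVec p) m‖ ^ 2 * ‖sAl N (ofRealVec p) m κ‖ ^ 2
      ≤ (((N : ℝ) ^ 2) ^ D * ∏ i, sinWt N (kfine N p m i)) * (N : ℝ) ^ 2 :=
        mul_le_mul (norm_SAl_sq_le p m) (norm_sAl_sq_le_sq p m κ) (sq_nonneg _)
          (mul_nonneg (by positivity) (prod_sinWt_nonneg p m))
    _ = ((N : ℝ) ^ (D + 1)) ^ 2 * ∏ i, sinWt N (kfine N p m i) := by ring

/-- [folklore] The norm of a product of two norms-as-reals is handled by `norm_mul`; recorded: `‖S(m)·s_κ(m)‖ = ‖S(m)‖·‖s_κ(m)‖`. -/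
theorem norm_SAl_mul_sAl (p : Fin D → ℂ) (m : TorusSite D N) (κ : Fin D) :
    ‖SAl N p m * sAl N p m κ‖ = ‖SAl N p m‖ * ‖sAl N p m κ‖ := norm_mul _ _

/-! ## §3 The cross sums -/

section Sums

variable {M : ℕ} (hM : 0 < M) (hMN : M ≤ N) {p : Fin D → ℝ} (hp : ∀ i, |p i| ≤ π)
include hM hMN hp

/-- [folklore] **φ-FEED SUM** (interface gap G1 of the Y09b cross-read): for all `κ l ρ`,
`Σ_{m≠0} ‖readW(m,κ,ρ)‖·(‖χ̂(m)‖·‖s♭_l(m)‖)/(N²·lapR k_m) ≤ (N/M)^{D+1}·N·aliasWtConst D`. -/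
theorem offZero_readW_chiAl_sbAl_sum_le (κ l : Fin D) (ρ : Fin D → ℤ) :
    ∑ m ∈ (Finset.univ : Finset (TorusSite D N)).erase 0,
        ‖readW N M (ofRealVec p) m κ ρ‖ * (‖chiAl N (ofRealVec p) m‖ * ‖sbAl N (ofRealVec p) m l‖) /
          ((N : ℝ) ^ 2 * lapR (kfine N p m))
      ≤ ((N : ℝ) / M) ^ (D + 1) * N * aliasWtConst D :=
  offZero_weighted_sum_le hp _ _ (by positivity) (Nat.cast_nonneg N) (fun m => norm_nonneg _)
    (fun m => mul_nonneg (norm_nonneg _) (norm_nonneg _)) (fun m => norm_readW_sq_le_prod hM hMN p m κ ρ)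
    (fun m => norm_chiAl_mul_sbAl_sq_le p m l)

/-- [folklore] **GAUGE-COLUMN SUM** (interface gap G2): `Σ_{m≠0} ‖readW(m,κ,ρ)‖·‖χ̂(m)‖/(N²·lapR k_m) ≤ (N/M)^{D+1}·aliasWtConst D`. -/
theorem offZero_readW_chiAl_sum_le (κ : Fin D) (ρ : Fin D → ℤ) :
    ∑ m ∈ (Finset.univ : Finset (TorusSite D N)).erase 0,
        ‖readW N M (ofRealVec p) m κ ρ‖ * ‖chiAl N (ofRealVec p) m‖ / ((N : ℝ) ^ 2 * lapR (kfine N p m))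
      ≤ ((N : ℝ) / M) ^ (D + 1) * aliasWtConst D := by
  have h := offZero_weighted_sum_le hp _ _ (by positivity : (0 : ℝ) ≤ ((N : ℝ) / M) ^ (D + 1)) zero_le_one
    (fun m => norm_nonneg _) (fun m => norm_nonneg _) (fun m => norm_readW_sq_le_prod hM hMN p m κ ρ)
    (fun m => norm_chiAl_sq_le' p m)
  rwa [mul_one] at h

/-- [folklore] **GAUGE-COLUMN SUM, `3/2` form**: `Σ_{m≠0} ‖readW‖·‖χ̂‖/((N² lapR)·√(N² lapR)) ≤ (N/M)^{D+1}·aliasWtConst D/2`. -/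
theorem offZero_readW_chiAl_sum_three_halves_le (κ : Fin D) (ρ : Fin D → ℤ) :
    ∑ m ∈ (Finset.univ : Finset (TorusSite D N)).erase 0,
        ‖readW N M (ofRealVec p) m κ ρ‖ * ‖chiAl N (ofRealVec p) m‖ /
          (((N : ℝ) ^ 2 * lapR (kfine N p m)) * Real.sqrt ((N : ℝ) ^ 2 * lapR (kfine N p m)))
      ≤ ((N : ℝ) / M) ^ (D + 1) * aliasWtConst D / 2 := by
  have h := offZero_weighted_sum_three_halves_le hp _ _ (by positivity : (0 : ℝ) ≤ ((N : ℝ) / M) ^ (D + 1)) zero_le_one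
    (fun m => norm_nonneg _) (fun m => norm_nonneg _) (fun m => norm_readW_sq_le_prod hM hMN p m κ ρ)
    (fun m => norm_chiAl_sq_le' p m)
  rwa [mul_one] at h

/-- [folklore] **ZERO-CLASS CROSS SUM, force part** (G3b): `Σ_{m≠0} (‖S(m)‖·‖s_κ(m)‖)·‖N^D·srcW(m,l,ρ′)‖/(N²·lapR k_m)
≤ N^{D+1}·(N/M)^{D+1}·aliasWtConst D`. -/
theorem offZero_SsAl_srcW_sum_le (κ l : Fin D) (ρ' : Fin D → ℤ) :
    ∑ m ∈ (Finset.univ : Finset (TorusSite D N)).erase 0,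
        (‖SAl N (ofRealVec p) m‖ * ‖sAl N (ofRealVec p) m κ‖) * ‖(N : ℂ) ^ D * srcW N M (ofRealVec p) m l ρ'‖ /
          ((N : ℝ) ^ 2 * lapR (kfine N p m))
      ≤ (N : ℝ) ^ (D + 1) * ((N : ℝ) / M) ^ (D + 1) * aliasWtConst D :=
  offZero_weighted_sum_le hp _ _ (by positivity) (by positivity) (fun m => mul_nonneg (norm_nonneg _) (norm_nonneg _))
    (fun m => norm_nonneg _) (fun m => norm_SAl_mul_sAl_sq_le p m κ) (fun m => norm_natPow_mul_srcW_sq_le_prod hM hMN p m l ρ')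

omit hM hMN in
/-- [folklore] **ZERO-CLASS CROSS SUM, gauge part** (G3b): `Σ_{m≠0} (‖S(m)‖·‖s_κ(m)‖)·‖χ̂(m)‖/(N²·lapR k_m) ≤ N^{D+1}·aliasWtConst D`. -/
theorem offZero_SsAl_chiAl_sum_le (κ : Fin D) :
    ∑ m ∈ (Finset.univ : Finset (TorusSite D N)).erase 0,
        (‖SAl N (ofRealVec p) m‖ * ‖sAl N (ofRealVec p) m κ‖) * ‖chiAl N (ofRealVec p) m‖ / ((N : ℝ) ^ 2 * lapR (kfine N p m))
      ≤ (N : ℝ) ^ (D + 1) * aliasWtConst D := by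
  have h := offZero_weighted_sum_le hp _ _ (by positivity : (0 : ℝ) ≤ (N : ℝ) ^ (D + 1)) zero_le_one
    (fun m => mul_nonneg (norm_nonneg _) (norm_nonneg _)) (fun m => norm_nonneg _) (fun m => norm_SAl_mul_sAl_sq_le p m κ)
    (fun m => norm_chiAl_sq_le' p m)
  rwa [mul_one] at h

omit hM hMN in
/-- [folklore] **ZERO-CLASS CROSS SUM, gauge part, `3/2` form**: `… /((N² lapR)·√(N² lapR)) ≤ N^{D+1}·aliasWtConst D/2`. -/
theorem offZero_SsAl_chiAl_sum_three_halves_le (κ : Fin D) :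
    ∑ m ∈ (Finset.univ : Finset (TorusSite D N)).erase 0,
        (‖SAl N (ofRealVec p) m‖ * ‖sAl N (ofRealVec p) m κ‖) * ‖chiAl N (ofRealVec p) m‖ /
          (((N : ℝ) ^ 2 * lapR (kfine N p m)) * Real.sqrt ((N : ℝ) ^ 2 * lapR (kfine N p m)))
      ≤ (N : ℝ) ^ (D + 1) * aliasWtConst D / 2 := by
  have h := offZero_weighted_sum_three_halves_le hp _ _ (by positivity : (0 : ℝ) ≤ (N : ℝ) ^ (D + 1)) zero_le_one
    (fun m => mul_nonneg (norm_nonneg _) (norm_nonneg _)) (fun m => norm_nonneg _) (fun m => norm_SAl_mul_sAl_sq_le p m κ)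
    (fun m => norm_chiAl_sq_le' p m)
  rwa [mul_one] at h

omit hM hMN in
/-- [folklore] **ZERO-CLASS CROSS SUM, φ-feed part** (G3b): `Σ_{m≠0} (‖S‖·‖s_κ‖)·(‖χ̂‖·‖s♭_l‖)/(N²·lapR) ≤ N^{D+1}·N·aliasWtConst D`. -/
theorem offZero_SsAl_chiAl_sbAl_sum_le (κ l : Fin D) :
    ∑ m ∈ (Finset.univ : Finset (TorusSite D N)).erase 0,
        (‖SAl N (ofRealVec p) m‖ * ‖sAl N (ofRealVec p) m κ‖) * (‖chiAl N (ofRealVec p) m‖ * ‖sbAl N (ofRealVec p) m l‖) /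
          ((N : ℝ) ^ 2 * lapR (kfine N p m))
      ≤ (N : ℝ) ^ (D + 1) * N * aliasWtConst D :=
  offZero_weighted_sum_le hp _ _ (by positivity) (Nat.cast_nonneg N) (fun m => mul_nonneg (norm_nonneg _) (norm_nonneg _))
    (fun m => mul_nonneg (norm_nonneg _) (norm_nonneg _)) (fun m => norm_SAl_mul_sAl_sq_le p m κ)
    (fun m => norm_chiAl_mul_sbAl_sq_le p m l)

/-- [folklore] **READING × SOURCE in engine form** (consistency with row P1-Y09b's `offZero_sum_le`, which is sharper by `(N/M)²`):
`Σ_{m≠0} ‖readW‖·‖N^D srcW‖/(N² lapR) ≤ ((N/M)^{D+1})²·aliasWtConst D`. -/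
theorem offZero_readW_srcW_sum_le (κ l : Fin D) (ρ ρ' : Fin D → ℤ) :
    ∑ m ∈ (Finset.univ : Finset (TorusSite D N)).erase 0,
        ‖readW N M (ofRealVec p) m κ ρ‖ * ‖(N : ℂ) ^ D * srcW N M (ofRealVec p) m l ρ'‖ / ((N : ℝ) ^ 2 * lapR (kfine N p m))
      ≤ ((N : ℝ) / M) ^ (D + 1) * ((N : ℝ) / M) ^ (D + 1) * aliasWtConst D :=
  offZero_weighted_sum_le hp _ _ (by positivity) (by positivity) (fun m => norm_nonneg _) (fun m => norm_nonneg _)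
    (fun m => norm_readW_sq_le_prod hM hMN p m κ ρ) (fun m => norm_natPow_mul_srcW_sq_le_prod hM hMN p m l ρ')

end Sums

/-! ## §4 The denominator dictionary for row P1-Y09a's `α(m)` -/

/-- [folklore] `‖L_m‖ = lapR k_m` at real momentum (`CapacitanceScalarDictionary.LAl_ofRealVec` BY NAME; `lapR ≥ 0`). -/
theorem norm_LAl_ofRealVec (p : Fin D → ℝ) (m : TorusSite D N) : ‖LAl N (ofRealVec p) m‖ = lapR (kfine N p m) := by
  rw [LAl_ofRealVec, Complex.norm_real, Real.norm_of_nonneg (lapR_nonneg _)]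

/-- [folklore] `1/‖L_m‖ = N²/(N²·lapR k_m)` (`N ≥ 1`): the conversion between Y09a's denominators and the T-block majorant. -/
theorem inv_norm_LAl_eq (p : Fin D → ℝ) (m : TorusSite D N) :
    1 / ‖LAl N (ofRealVec p) m‖ = (N : ℝ) ^ 2 / ((N : ℝ) ^ 2 * lapR (kfine N p m)) := by
  have hN : (N : ℝ) ^ 2 ≠ 0 := pow_ne_zero _ (Nat.cast_ne_zero.2 (NeZero.ne N))
  rw [norm_LAl_ofRealVec, div_mul_eq_div_div, div_self hN]

/-- [folklore] `‖L_m‖·√‖L_m‖ = (N² lapR)·√(N² lapR)/N³` (`N ≥ 1`): the `3/2`-power conversion. -/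
theorem norm_LAl_mul_sqrt_eq (p : Fin D → ℝ) (m : TorusSite D N) :
    ‖LAl N (ofRealVec p) m‖ * Real.sqrt ‖LAl N (ofRealVec p) m‖ =
      ((N : ℝ) ^ 2 * lapR (kfine N p m)) * Real.sqrt ((N : ℝ) ^ 2 * lapR (kfine N p m)) / (N : ℝ) ^ 3 := by
  have hN : (0 : ℝ) < N := Nat.cast_pos.2 (Nat.pos_of_ne_zero (NeZero.ne N))
  have hN3 : (N : ℝ) ^ 3 ≠ 0 := pow_ne_zero _ hN.ne'
  rw [norm_LAl_ofRealVec, Real.sqrt_mul' _ (lapR_nonneg _), Real.sqrt_sq hN.le, eq_div_iff hN3]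
  ring

end Summit.QuantumFields.BalabanUV.Beta.GAN24.ReadingWeightCrossSums

end
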